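import Summits.ResolutionOfSingularities.ResolutionOfSingularities.Theorems.MarkedTransferCampaignW46MohWindowShadeFormalNRChart
import HarnessLib

/-!
# [OURS · L1 W4.6 rung (iii-2), NON-RATIONAL POINTS, brick 9] Descent of the `p`-fold formal curve factor along an extension of the
# coefficient field: `F ⊗ Ω = (y_i − ψ(y_j) ⊗ Ω)^n · W` with `F, ψ` over `L` ⟹ `F = (y_i − ψ(y_j))^n · W′` over `L`

Cell `res-hironaka`, LADDER-RESOLUTION rung L (D-0089), slot W4.6 rung (iii); seat res-L1-s46-pv-6 (gen 7). Host route MarkedTransfer,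
`--supports stmt-ResolutionOfSingularities-16155 --as helper`; kind proof (no definition). The model walk of a thread through non-rational
points runs in `Ω⟦y⟧` (`Ω` an algebraic closure); its conclusion `F_n ⊗ Ω = (y_i − ψ)^p · W` (this seat's gen-3/6 theorem over `Ω`) must be
read back in the Cohen coordinates `L_n⟦z, u⟧` of the stage, `L_n ⊆ Ω` the coefficient field of the point. When the digits (the coefficients of
`ψ`) lie in `L_n` — which the DEGREE LAW guarantees late in the walk (`…FormalNRWalk`) — divisibility descends WITHOUT Galois theory: the shear
`y_i ↦ y_i + ψ(y_j)` (an automorphism over `L` and over `Ω`, compatible with `⊗ Ω` by the uniqueness of local maps out of `L⟦y⟧`,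
`ringHom_ext_of_apply_X_mem`) turns `y_i − ψ` into `y_i`, and divisibility by a power of a VARIABLE is a coefficient condition
(`MvPowerSeries.X_pow_dvd_iff`), invariant under the injective `⊗ Ω`. Pure algebra; NOTHING here is a statement of H. Hironaka's manuscript
[Hironaka2017] and nothing of it is used. AI-written; AI review is weaker than expert review. References: tree `WildConesCampaignW46FormalChart`
(`exists_algEquiv_shear`); Mathlib `MvPowerSeries.subst`, `X_pow_dvd_iff`. [folklore]
-/

noncomputable section

set_option linter.dupNamespace false -- mandated namespace of this single-conjunct summit

open MvPowerSeries IsLocalRing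

namespace Summit.ResolutionOfSingularities.ResolutionOfSingularities.Theorems

namespace CampaignW46

namespace MohWindowShadeFormalNR

open CampaignW46.FormalChart (exists_algEquiv_shear hasSubst_kill)
open Literature.RingTheory.MvPowerSeries.Jets (algHom_apply_eq_subst hasSubst_algHom_X mem_maximalIdeal_iff_constantCoeff_eq_zero)

/-! ## §1 Series in one variable are fixed by substitutions fixing that variable -/

section OneVariable

variable {σ : Type*} [DecidableEq σ] {R : Type*} [CommRing R]

/-- **A substitution fixing `y_j` fixes every series in `y_j` alone.** [folklore] -/
theorem subst_eq_self_of_supported {a : σ → MvPowerSeries σ R} (ha : HasSubst a) (j : σ) (haj : a j = X j) (ψ : MvPowerSeries σ R)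
    (hψ : ∀ e, coeff e ψ ≠ 0 → e = Finsupp.single j (e j)) : subst a ψ = ψ := by
  classical
  ext e
  rw [coeff_subst ha ψ e]
  have hterm : ∀ d : σ →₀ ℕ, coeff d ψ • coeff e (d.prod fun s n => a s ^ n) = if d = e then coeff e ψ else 0 := by
    intro d
    by_cases hd : coeff d ψ = 0
    · rw [hd, zero_smul]; split_ifs with h
      · rw [← h, hd]
      · rfl
    · have hde : d = Finsupp.single j (d j) := hψ d hd
      have hprod : (d.prod fun s n => a s ^ n) = monomial d (1 : R) := by
        conv_lhs => rw [hde]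
        rw [Finsupp.prod_single_index (by rw [pow_zero]), haj, X_pow_eq, ← hde]
      rw [hprod, coeff_monomial, smul_eq_mul]
      split_ifs with h1 h2 h2
      · rw [h2, mul_one]
      · exact absurd h1.symm h2
      · exact absurd h2.symm h1
      · rw [mul_zero]
  simp_rw [hterm]
  rw [finsum_eq_single _ e (fun d hd => if_neg hd), if_pos rfl]

end OneVariable

/-! ## §2 The descent -/

section Descent

variable {L Ω : Type} [Field L] [Field Ω] (ι : L →+* Ω) {j i : Fin 2} (hij : i ≠ j)

/-- Support condition is preserved by the coefficient map. [folklore] -/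
theorem supported_map {ψ : MvPowerSeries (Fin 2) L} (hψ : ∀ e, coeff e ψ ≠ 0 → e = Finsupp.single j (e j)) :
    ∀ e, coeff e (MvPowerSeries.map ι ψ) ≠ 0 → e = Finsupp.single j (e j) := fun e he => by
  rw [coeff_map] at he
  exact hψ e fun h => he (by rw [h, map_zero])

include hij in
/-- A series in `y_j` alone is fixed by the killing of `y_i`. [folklore] -/
theorem kill_eq_self {M : Type} [Field M] {ψ : MvPowerSeries (Fin 2) M} (hψ : ∀ e, coeff e ψ ≠ 0 → e = Finsupp.single j (e j)) :
    subst (fun l : Fin 2 => if l = i then (0 : MvPowerSeries (Fin 2) M) else X l) ψ = ψ :=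
  subst_eq_self_of_supported (hasSubst_kill i) j (by rw [if_neg hij.symm]) ψ hψ

include hij in
/-- **The shear `y_i ↦ y_i + ψ(y_j)`** over a field, fixing series in `y_j` alone; with its inverse on `y_i`. [folklore] -/
theorem exists_shear {M : Type} [Field M] (ψ : MvPowerSeries (Fin 2) M) (hψ0 : constantCoeff ψ = 0)
    (hψ : ∀ e, coeff e ψ ≠ 0 → e = Finsupp.single j (e j)) :
    ∃ θ : MvPowerSeries (Fin 2) M ≃ₐ[M] MvPowerSeries (Fin 2) M, θ (X i) = X i + ψ ∧ θ (X j) = X j ∧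
      (∀ φ : MvPowerSeries (Fin 2) M, (∀ e, coeff e φ ≠ 0 → e = Finsupp.single j (e j)) → θ φ = φ) ∧ θ.symm (X i) = X i - ψ := by
  obtain ⟨θ, hθi, hθj⟩ := exists_algEquiv_shear i ψ hψ0 (kill_eq_self hij hψ)
  have hθj' : θ (X j) = X j := hθj j hij.symm
  have hfix : ∀ φ : MvPowerSeries (Fin 2) M, (∀ e, coeff e φ ≠ 0 → e = Finsupp.single j (e j)) → θ φ = φ := by
    intro φ hφ
    rw [show θ φ = θ.toAlgHom φ from rfl, algHom_apply_eq_subst]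
    exact subst_eq_self_of_supported (hasSubst_algHom_X θ.toAlgHom) j hθj' φ hφ
  refine ⟨θ, hθi, hθj', hfix, ?_⟩
  have h1 : θ (X i - ψ) = X i := by rw [map_sub, hθi, hfix ψ hψ, add_sub_cancel_right]
  have h2 := AlgEquiv.symm_apply_apply θ (X i - ψ)
  rw [h1] at h2
  exact h2

include hij in
/-- [OURS · L1 W4.6 rung (iii-2) — DESCENT OF THE `p`-FOLD CURVE; NOT a statement of the manuscript] **`F ⊗ Ω = (y_i − ψ ⊗ Ω)^n · W` with
`F, ψ` over `L` (`ψ` a series in `y_j` alone without constant term) implies `F = (y_i − ψ)^n · W′` over `L`.** See the module docstring.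
[folklore] -/
theorem exists_eq_pow_mul_of_map (n : ℕ) (ψ : MvPowerSeries (Fin 2) L) (hψ0 : constantCoeff ψ = 0)
    (hψ : ∀ e, coeff e ψ ≠ 0 → e = Finsupp.single j (e j)) (F : MvPowerSeries (Fin 2) L) (W : MvPowerSeries (Fin 2) Ω)
    (hF : MvPowerSeries.map ι F = (X i - MvPowerSeries.map ι ψ) ^ n * W) :
    ∃ W' : MvPowerSeries (Fin 2) L, F = (X i - ψ) ^ n * W' := by
  classical
  haveI : IsNoetherianRing (MvPowerSeries (Fin 2) Ω) :=
    (Literature.AlgebraicGeometry.Resolution.isRegularLocalRing_mvPowerSeries Ω (Fin 2)).toIsNoetherian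
  obtain ⟨θL, hLi, hLj, hLfix, hLsymm⟩ := exists_shear hij ψ hψ0 hψ
  have hψ0' : constantCoeff (MvPowerSeries.map ι ψ) = 0 := by
    rw [← coeff_zero_eq_constantCoeff_apply, coeff_map, coeff_zero_eq_constantCoeff_apply, hψ0, map_zero]
  obtain ⟨θΩ, hΩi, hΩj, hΩfix, -⟩ := exists_shear hij (MvPowerSeries.map ι ψ) hψ0' (supported_map ι hψ)
  -- the shears commute with the coefficient map
  have htwo : ∀ l : Fin 2, l = j ∨ l = i := by
    intro l
    by_cases h : l = j
    · exact Or.inl h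
    · have key : ∀ a b c : Fin 2, a ≠ c → b ≠ c → a = b := by decide
      exact Or.inr (key l i j h hij)
  have hcompat : ((MvPowerSeries.map ι).comp (θL : MvPowerSeries (Fin 2) L →+* MvPowerSeries (Fin 2) L)) =
      ((θΩ : MvPowerSeries (Fin 2) Ω →+* MvPowerSeries (Fin 2) Ω).comp (MvPowerSeries.map ι)) := by
    have hθC : ∀ (M : Type) [Field M] (θ : MvPowerSeries (Fin 2) M ≃ₐ[M] MvPowerSeries (Fin 2) M) (c : M), θ (C c) = C c :=
      fun M _ θ c => by rw [MvPowerSeries.c_eq_algebraMap]; exact θ.commutes c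
    refine ringHom_ext_of_apply_X_mem _ _ (fun s => ?_) (fun s => ?_) (fun c => ?_) (fun s => ?_)
    · rw [RingHom.comp_apply, RingHom.coe_coe, mem_maximalIdeal_iff_constantCoeff_eq_zero]
      rcases htwo s with rfl | rfl
      · rw [hLj, MvPowerSeries.map_X, constantCoeff_X]
      · rw [hLi, map_add, MvPowerSeries.map_X, map_add, constantCoeff_X, hψ0', add_zero]
    · rw [RingHom.comp_apply, RingHom.coe_coe, MvPowerSeries.map_X, mem_maximalIdeal_iff_constantCoeff_eq_zero]
      rcases htwo s with rfl | rfl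
      · rw [hΩj, constantCoeff_X]
      · rw [hΩi, map_add, constantCoeff_X, hψ0', add_zero]
    · rw [RingHom.comp_apply, RingHom.comp_apply, RingHom.coe_coe, RingHom.coe_coe, hθC L θL, MvPowerSeries.map_C, hθC Ω θΩ]
    · rw [RingHom.comp_apply, RingHom.comp_apply, RingHom.coe_coe, RingHom.coe_coe, MvPowerSeries.map_X]
      rcases htwo s with rfl | rfl
      · rw [hLj, hΩj, MvPowerSeries.map_X]
      · rw [hLi, hΩi, map_add, MvPowerSeries.map_X]
  have hcompat' : ∀ f, MvPowerSeries.map ι (θL f) = θΩ (MvPowerSeries.map ι f) := fun f => by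
    have := congrArg (fun χ => χ f) hcompat
    simpa only [RingHom.comp_apply, RingHom.coe_coe] using this
  -- `X_i^n` divides `θ_Ω (F ⊗ Ω) = θ_L(F) ⊗ Ω`
  have hdivΩ : (X i : MvPowerSeries (Fin 2) Ω) ^ n ∣ MvPowerSeries.map ι (θL F) := by
    rw [hcompat', hF, map_mul, map_pow, map_sub, hΩi, hΩfix _ (supported_map ι hψ), add_sub_cancel_right]
    exact dvd_mul_right _ _
  have hdivL : (X i : MvPowerSeries (Fin 2) L) ^ n ∣ θL F := by
    rw [X_pow_dvd_iff] at hdivΩ ⊢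
    intro m hm
    have h := hdivΩ m hm
    rw [coeff_map] at h
    exact (map_eq_zero_iff ι ι.injective).mp h
  obtain ⟨G, hG⟩ := hdivL
  refine ⟨θL.symm G, ?_⟩
  have h1 : F = θL.symm (θL F) := (AlgEquiv.symm_apply_apply θL F).symm
  rw [h1, hG, map_mul, map_pow, hLsymm]

end Descent

end MohWindowShadeFormalNR

end CampaignW46

end Summit.ResolutionOfSingularities.ResolutionOfSingularities.Theorems

end
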